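import Mathlib.Analysis.SpecialFunctions.Trigonometric.Bounds
import Mathlib.Analysis.SpecialFunctions.Trigonometric.Deriv
import Summits.QuantumFields.BalabanUV.T4Continuum.Spine.NE4.FadingFromRate

/-!
# Spine/NE4/FadingFromRateSharp — the exchange rate `θ ↦ √θ` of `Spine/NE4/FadingFromRate` is OPTIMAL under C^{1,1} regularity: an explicit
# family with NE4 at rate `θ`, bounded second derivatives and a uniform bound, whose EVERY Lipschitz-moduli family fades no faster than `√θ^{age}`

Cell `pub-balaban-gaps` (YM blitz G2), seat `ne4`, generation 3; record `HOME/ne/NE4.md` §5 (R29) «SHARPNESS».  `Spine/NE4/FadingFromRate`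
(`histLipschitz_fadingMemory_of_smooth`) derives node U2's history companions `HistLipschitz Λ₁ ∧ FadingMemory C₁ τ Λ₁` from NE4 (`ScaleShiftRate c θ`),
a uniform bound and the C^{1,1} bound `CoordDerivLipschitz M`, for every rate `τ` with `θ ≤ τ²` — at best `τ = √θ`.  THIS FILE: `√θ` cannot be
improved.  The witness is the family `sharpFamily θ γ k v = θ^k·sin(ω_k·v₀)`, `ω_k = (π∕γ)∕(√θ)^k` — dependence on the OLDEST coupling only, with
oscillation `θ^k` (so NE4 holds with `c = 2`), bounded by `1`, second derivative in `g₀` bounded by `θ^k·ω_k² = (π∕γ)²` UNIFORMLY in `k`, but first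
derivative of size `θ^kω_k = (π∕γ)(√θ)^k`: any moduli family `Λ` validating `HistLipschitz Λ γ β` has `Λ k 0 ≥ (2∕γ)(√θ)^k` (evaluate at
`g₀ = (γ∕2)(√θ)^k`, `γ(√θ)^k`, where `sin` takes the values `1`, `0`), hence `FadingMemory C θ′ Λ` fails for every constant `C` and every rate
`θ′ < √θ` (§2–§3), while at `θ′ = √θ` it holds by the positive theorem (§3 `fadingMemory_sharpFamily_sqrt`).  So under a C^{1,1} bound alone the
decay derived from NE4 is EXACTLY `√θ^{age}`; faster decay needs more derivatives (`θ^{(1−1∕(n+1))·age}` from `n` Lipschitz derivatives) or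
analyticity with a uniform complex bound (`θ^{age}·O(age)`), as recorded in `FadingFromRate`'s header — none of which node U2 needs.

HONEST FRAMING: a statement about the cell's HYPOTHESIS SHAPES on an artificial family `β : FlowStep.HBeta` (harness hygiene ∕ negative knowledge
about the shapes), NOT about Bałaban's β-functions; nothing printed is touched; NE4 NOT IN PRINT, NOT PROVED; spine PROVED 0∕9 unchanged; NOT the
continuum limit on ℝ⁴, NOT infinite volume, NOT a mass gap, NOT Clay.  Reference (TYPES only): [Balaban1987RG1] = T. Bałaban, Commun. Math. Phys.
**109** (1987) 249–301, p. 264 (the regularity clause whose C^{1,1} reading is `CoordDerivLipschitz`).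
-/

noncomputable section

namespace Summit.QuantumFields.BalabanUV.T4Continuum.Spine.NE4

open Set Real
open Literature.MathematicalPhysics.QuantumFieldTheory.Balaban1983to89
open Literature.MathematicalPhysics.QuantumFieldTheory.Balaban1983to89.FlowStep
open Literature.MathematicalPhysics.QuantumFieldTheory.Balaban1983to89.T4CouplingMatching

/-! ## §1 The witness family and its positive properties (NE4 at rate θ, uniform bound, C^{1,1} with one constant) -/

/-- The frequency of the witness at scale `k`: `ω_k = (π∕γ)∕(√θ)^k`. [folklore] -/
def sharpFreq (θ γ : ℝ) (k : ℕ) : ℝ := (π / γ) / (Real.sqrt θ) ^ k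

/-- THE WITNESS FAMILY `β_{k+1}(g_0,…,g_k) = θ^k·sin(ω_k·g_0)`: dependence on the OLDEST coupling only, amplitude `θ^k`, frequency `ω_k` — fast
small wiggles.  An artificial inhabitant of the shapes, not a model of (1.22). [folklore] -/
def sharpFamily (θ γ : ℝ) : HBeta := fun k v => θ ^ k * Real.sin (sharpFreq θ γ k * v 0)

/-- `|sharpFamily θ γ k v| ≤ θ^k`. [folklore] -/
theorem abs_sharpFamily_le_pow {θ γ : ℝ} (hθ0 : 0 ≤ θ) (k : ℕ) (v : Fin (k + 1) → ℝ) : |sharpFamily θ γ k v| ≤ θ ^ k := by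
  unfold sharpFamily
  rw [abs_mul, abs_of_nonneg (pow_nonneg hθ0 k)]
  exact mul_le_of_le_one_right (pow_nonneg hθ0 k) (abs_sin_le_one _)

/-- The uniform bound: `|sharpFamily θ γ k v| ≤ 1` for `0 ≤ θ ≤ 1` (the `B = 1` of `FadingFromRate`). [folklore] -/
theorem abs_sharpFamily_le_one {θ γ : ℝ} (hθ0 : 0 ≤ θ) (hθ1 : θ ≤ 1) (k : ℕ) (v : Fin (k + 1) → ℝ) : |sharpFamily θ γ k v| ≤ 1 :=
  (abs_sharpFamily_le_pow hθ0 k v).trans (pow_le_one₀ hθ0 hθ1)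

/-- **NE4 AT RATE θ**: `ScaleShiftRate 2 θ γ (sharpFamily θ γ)` — both terms of `β (k+1) w − β k (Fin.tail w)` have amplitude `≤ θ^k`. [folklore] -/
theorem scaleShiftRate_sharpFamily {θ γ : ℝ} (hθ0 : 0 ≤ θ) (hθ1 : θ ≤ 1) : ScaleShiftRate 2 θ γ (sharpFamily θ γ) := by
  intro k w _
  have h1 := abs_sharpFamily_le_pow (γ := γ) hθ0 (k + 1) w
  have h2 := abs_sharpFamily_le_pow (γ := γ) hθ0 k (Fin.tail w)
  have hθk : θ ^ (k + 1) ≤ θ ^ k := pow_le_pow_of_le_one hθ0 hθ1 (Nat.le_succ k)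
  calc |sharpFamily θ γ (k + 1) w - sharpFamily θ γ k (Fin.tail w)|
      ≤ |sharpFamily θ γ (k + 1) w| + |sharpFamily θ γ k (Fin.tail w)| := abs_sub _ _
    _ ≤ 2 * θ ^ k := by linarith

/-- `θ^k·ω_k² = (π∕γ)²` (`(√θ)^{2k} = θ^k`, `θ > 0`): the second derivative of the witness in `g_0` is bounded UNIFORMLY in the scale. [folklore] -/
theorem pow_mul_sharpFreq_sq {θ γ : ℝ} (hθ0 : 0 < θ) (k : ℕ) : θ ^ k * sharpFreq θ γ k ^ 2 = (π / γ) ^ 2 := by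
  have hs : 0 < Real.sqrt θ := Real.sqrt_pos.mpr hθ0
  have hsk : (Real.sqrt θ ^ k) ^ 2 = θ ^ k := by
    rw [← pow_mul, mul_comm, pow_mul, Real.sq_sqrt hθ0.le]
  unfold sharpFreq
  rw [div_pow, ← hsk]
  field_simp

/-- **C^{1,1} WITH ONE CONSTANT**: `CoordDerivLipschitz ((π∕γ)²) γ (sharpFamily θ γ)` for `θ > 0` — in the coordinate `0` the derivative
`θ^kω_k·cos(ω_k g)` is `θ^kω_k²`-Lipschitz (`|cos a − cos b| ≤ |a − b|`), and `θ^kω_k² = (π∕γ)²`; in every other coordinate the section is constant.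
[folklore] -/
theorem coordDerivLipschitz_sharpFamily {θ γ : ℝ} (hθ0 : 0 < θ) : CoordDerivLipschitz ((π / γ) ^ 2) γ (sharpFamily θ γ) := by
  intro k p _ i
  by_cases hi : i = 0
  · subst hi
    set ω : ℝ := sharpFreq θ γ k with hω
    refine ⟨fun g => θ ^ k * (ω * Real.cos (ω * g)), fun g _ => ?_, fun s _ t _ => ?_⟩
    · have hd : HasDerivAt (fun g : ℝ => θ ^ k * Real.sin (ω * g)) (θ ^ k * (Real.cos (ω * g) * (ω * 1))) g :=
        (((hasDerivAt_id g).const_mul ω).sin).const_mul (θ ^ k)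
      have e : (fun g : ℝ => sharpFamily θ γ k (Function.update p 0 g)) = fun g => θ ^ k * Real.sin (ω * g) := by
        funext g; simp [sharpFamily, hω]
      rw [e]
      exact (hd.congr_deriv (by ring)).hasDerivWithinAt
    · have hcos := abs_cos_sub_cos_le (ω * s) (ω * t)
      have hθk : 0 ≤ θ ^ k := pow_nonneg hθ0.le k
      have hωabs : |ω| * |ω| = ω ^ 2 := by rw [← abs_mul, ← sq, abs_of_nonneg (sq_nonneg ω)]
      calc |θ ^ k * (ω * Real.cos (ω * s)) - θ ^ k * (ω * Real.cos (ω * t))|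
          = θ ^ k * (|ω| * |Real.cos (ω * s) - Real.cos (ω * t)|) := by
            rw [← mul_sub, ← mul_sub, abs_mul, abs_mul, abs_of_nonneg hθk]
        _ ≤ θ ^ k * (|ω| * |ω * s - ω * t|) := mul_le_mul_of_nonneg_left (mul_le_mul_of_nonneg_left hcos (abs_nonneg ω)) hθk
        _ = θ ^ k * (|ω| * |ω|) * |s - t| := by rw [← mul_sub, abs_mul]; ring
        _ = (π / γ) ^ 2 * |s - t| := by rw [hωabs, hω, pow_mul_sharpFreq_sq hθ0 k]
  · refine ⟨fun _ => 0, fun g _ => ?_, fun s _ t _ => by simp only [sub_self, abs_zero]; positivity⟩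
    have e : (fun g : ℝ => sharpFamily θ γ k (Function.update p i g)) = fun _ => sharpFamily θ γ k p := by
      funext g
      simp only [sharpFamily]
      rw [Function.update_of_ne (Ne.symm hi)]
    rw [e]
    exact hasDerivWithinAt_const g _ _

/-! ## §2 The lower bound on any Lipschitz-moduli family -/

/-- **EVERY MODULI FAMILY IS LARGE IN THE OLDEST COUPLING**: if `HistLipschitz Λ γ (sharpFamily θ γ)` (`0 < θ ≤ 1`, `γ > 0`) then
`(2∕γ)·(√θ)^k ≤ Λ k 0` for every scale `k` — compare the histories `(s, γ, …, γ)` and `(t, γ, …, γ)` with `s = (γ∕2)(√θ)^k`, `t = γ(√θ)^k`, where the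
witness takes the values `θ^k·sin(π∕2) = θ^k` and `θ^k·sin π = 0`. [folklore] -/
theorem moduli_lower_sharpFamily {θ γ : ℝ} (hθ0 : 0 < θ) (hθ1 : θ ≤ 1) (hγ : 0 < γ) {Λ : ℕ → ℕ → ℝ}
    (hL : HistLipschitz Λ γ (sharpFamily θ γ)) (k : ℕ) : 2 / γ * Real.sqrt θ ^ k ≤ Λ k 0 := by
  have hs0 : 0 < Real.sqrt θ := Real.sqrt_pos.mpr hθ0
  have hs1 : Real.sqrt θ ≤ 1 := Real.sqrt_le_one.mpr hθ1 |>.trans_eq' rfl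
  set r : ℝ := Real.sqrt θ ^ k with hr
  have hr0 : 0 < r := pow_pos hs0 k
  have hr1 : r ≤ 1 := pow_le_one₀ hs0.le hs1
  set p : Fin (k + 1) → ℝ := Function.update (fun _ => γ) 0 (γ / 2 * r) with hp
  set q : Fin (k + 1) → ℝ := Function.update (fun _ => γ) 0 (γ * r) with hq
  have hbox : ∀ x : ℝ, 0 < x → x ≤ γ → Function.update (fun _ : Fin (k + 1) => γ) 0 x ∈ Box γ k := fun x hx0 hxγ => by
    rw [mem_box]; intro j
    by_cases hj : j = 0
    · subst hj; simpa using ⟨hx0, hxγ⟩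
    · rw [Function.update_of_ne hj]; exact ⟨hγ, le_rfl⟩
  have hpb : p ∈ Box γ k := hbox _ (by positivity) (by nlinarith)
  have hqb : q ∈ Box γ k := hbox _ (by positivity) (by nlinarith)
  have h := hL k p q hpb hqb
  -- the values of the witness
  have hωp : sharpFreq θ γ k * p 0 = π / 2 := by
    simp only [hp, Function.update_self, sharpFreq, hr]; field_simp
  have hωq : sharpFreq θ γ k * q 0 = π := by
    simp only [hq, Function.update_self, sharpFreq, hr]; field_simp
  have hval : |sharpFamily θ γ k p - sharpFamily θ γ k q| = θ ^ k := by
    simp only [sharpFamily, hωp, hωq, Real.sin_pi_div_two, Real.sin_pi, mul_one, mul_zero, sub_zero]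
    exact abs_of_nonneg (pow_nonneg hθ0.le k)
  -- the sum collapses to the coordinate 0
  have hsum : ∑ i : Fin (k + 1), Λ k i * |p i - q i| = Λ k 0 * (γ / 2 * r) := by
    rw [Finset.sum_eq_single (0 : Fin (k + 1))]
    · simp only [hp, hq, Function.update_self, Fin.val_zero]
      rw [show γ / 2 * r - γ * r = -(γ / 2 * r) by ring, abs_neg, abs_of_pos (by positivity)]
    · intro j _ hj
      simp [hp, hq, Function.update_of_ne hj]
    · simp
  rw [hval, hsum] at h
  -- θ^k = r², so θ^k ≤ Λ k 0 · (γ/2) r gives (2/γ) r ≤ Λ k 0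
  have hθk : θ ^ k = r * r := by
    rw [hr, ← mul_pow, Real.mul_self_sqrt hθ0.le]
  rw [hθk] at h
  have h' : r * (2 / γ * r) ≤ r * (Λ k 0) := by
    calc r * (2 / γ * r) = (2 / γ) * (r * r) := by ring
      _ ≤ (2 / γ) * (Λ k 0 * (γ / 2 * r)) := mul_le_mul_of_nonneg_left h (by positivity)
      _ = r * Λ k 0 := by field_simp
  exact le_of_mul_le_mul_left h' hr0

/-! ## §3 No rate below √θ; the rate √θ itself is attained -/

/-- **NO FADING RATE BELOW `√θ`.**  For `0 < θ ≤ 1`, `γ > 0`, any `Λ` with `HistLipschitz Λ γ (sharpFamily θ γ)`, any constant `C` and any rate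
`0 ≤ θ′ < √θ`: `¬ FadingMemory C θ′ Λ` (else `(2∕γ)(√θ)^k ≤ Cθ′^k` for all `k`, impossible as `√θ∕θ′ > 1`). [folklore] -/
theorem not_fadingMemory_sharpFamily {θ γ : ℝ} (hθ0 : 0 < θ) (hθ1 : θ ≤ 1) (hγ : 0 < γ) {Λ : ℕ → ℕ → ℝ}
    (hL : HistLipschitz Λ γ (sharpFamily θ γ)) {C θ' : ℝ} (hθ'0 : 0 ≤ θ') (hθ' : θ' < Real.sqrt θ) : ¬ FadingMemory C θ' Λ := by
  intro hF
  have hs0 : 0 < Real.sqrt θ := Real.sqrt_pos.mpr hθ0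
  have key : ∀ k : ℕ, 2 / γ * Real.sqrt θ ^ k ≤ C * θ' ^ k := fun k => by
    have h1 := moduli_lower_sharpFamily hθ0 hθ1 hγ hL k
    have h2 := (hF k 0 (Nat.zero_le k)).2
    rw [Nat.sub_zero] at h2
    exact h1.trans h2
  rcases hθ'0.eq_or_lt with h0 | hpos
  · -- θ' = 0: scale k = 1 gives (2/γ)√θ ≤ 0
    have h := key 1
    rw [← h0] at h
    simp only [pow_one, mul_zero] at h
    have : 0 < 2 / γ * Real.sqrt θ := by positivity
    linarith
  · -- θ' > 0: (√θ/θ')^k ≤ Cγ/2 for all k, contradicting √θ/θ' > 1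
    have hρ : 1 < Real.sqrt θ / θ' := (one_lt_div hpos).mpr hθ'
    obtain ⟨n, hn⟩ := pow_unbounded_of_one_lt (C * γ / 2) hρ
    have h := key n
    have hθn : 0 < θ' ^ n := pow_pos hpos n
    have : (Real.sqrt θ / θ') ^ n ≤ C * γ / 2 := by
      rw [div_pow, div_le_iff₀ hθn]
      have := mul_le_mul_of_nonneg_left h (by positivity : (0 : ℝ) ≤ γ / 2)
      calc Real.sqrt θ ^ n = γ / 2 * (2 / γ * Real.sqrt θ ^ n) := by field_simp
        _ ≤ γ / 2 * (C * θ' ^ n) := this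
        _ = C * γ / 2 * θ' ^ n := by ring
    linarith

/-- **… WHILE `√θ` IS ATTAINED** (the positive theorem of `FadingFromRate` on the witness): for `0 < θ < 1`, `γ > 0`, the moduli
`Λ₁ k i = C₁·(√θ)^{k−i}`, `C₁ = fadingConst 2 θ γ 1 ((π∕γ)²)`, satisfy `HistLipschitz Λ₁ γ (sharpFamily θ γ) ∧ FadingMemory C₁ (√θ) Λ₁`. [folklore] -/
theorem fadingMemory_sharpFamily_sqrt {θ γ : ℝ} (hθ0 : 0 < θ) (hθ1 : θ < 1) (hγ : 0 < γ) :
    HistLipschitz (fun k i => fadingConst 2 θ γ 1 ((π / γ) ^ 2) * Real.sqrt θ ^ (k - i)) γ (sharpFamily θ γ) ∧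
      FadingMemory (fadingConst 2 θ γ 1 ((π / γ) ^ 2)) (Real.sqrt θ)
        (fun k i => fadingConst 2 θ γ 1 ((π / γ) ^ 2) * Real.sqrt θ ^ (k - i)) :=
  histLipschitz_fadingMemory_of_smooth (scaleShiftRate_sharpFamily hθ0.le hθ1.le) (by norm_num) hθ0 hθ1
    (fun k v _ => abs_sharpFamily_le_one hθ0.le hθ1.le k v) (coordDerivLipschitz_sharpFamily hθ0) (sq_nonneg _) hγ
    (Real.sqrt_pos.mpr hθ0) (Real.sqrt_le_one.mpr hθ1.le |>.trans_eq' rfl) (le_of_eq (Real.sq_sqrt hθ0.le).symm)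

/-- **PACKAGED: `√θ` IS THE EXACT EXCHANGE RATE UNDER C^{1,1}.**  For every `0 < θ < 1` and `γ > 0` there is a family `β` with NE4 at rate `θ`
(`ScaleShiftRate 2 θ γ β`), `|β| ≤ 1` on the boxes and `CoordDerivLipschitz ((π∕γ)²) γ β`, for which fading Lipschitz moduli exist at rate `√θ` and
at NO rate `θ′ < √θ`. [folklore] -/
theorem sqrt_rate_exact {θ γ : ℝ} (hθ0 : 0 < θ) (hθ1 : θ < 1) (hγ : 0 < γ) :
    ∃ β : HBeta, ScaleShiftRate 2 θ γ β ∧ (∀ k (v : Fin (k + 1) → ℝ), v ∈ Box γ k → |β k v| ≤ 1) ∧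
      CoordDerivLipschitz ((π / γ) ^ 2) γ β ∧
      (∃ (C : ℝ) (Λ : ℕ → ℕ → ℝ), HistLipschitz Λ γ β ∧ FadingMemory C (Real.sqrt θ) Λ) ∧
      ∀ (Λ : ℕ → ℕ → ℝ), HistLipschitz Λ γ β → ∀ (C θ' : ℝ), 0 ≤ θ' → θ' < Real.sqrt θ → ¬ FadingMemory C θ' Λ :=
  ⟨sharpFamily θ γ, scaleShiftRate_sharpFamily hθ0.le hθ1.le, fun k v _ => abs_sharpFamily_le_one hθ0.le hθ1.le k v,
    coordDerivLipschitz_sharpFamily hθ0, ⟨_, _, fadingMemory_sharpFamily_sqrt hθ0 hθ1 hγ⟩,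
    fun _ hL _ _ hθ'0 hθ' => not_fadingMemory_sharpFamily hθ0 hθ1.le hγ hL hθ'0 hθ'⟩

end Summit.QuantumFields.BalabanUV.T4Continuum.Spine.NE4

end
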